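import Mathlib
import Literature.MathematicalPhysics.KineticTheory.HardSphereEuler
import Literature.Analysis.FluidPDE.HardSphereCollisionRecord
import HarnessLib

/-!
# Vocabulary of the line `hemisphere-affine-slaving` for the crux `CollisionalTransferLocality`
(stmt-AtomisticToContinuum-9518; rank 4 of route `CollisionIsometryCLT`, K2 = rank 3 of
`StiffCollisionalRelaxation`; the two route decls are `rfl`-equal)

Definitions-only support file (`--supports stmt-AtomisticToContinuum-9518`) of the lead prover of the
line (`Cruxes/CollisionalTransferLocality/Lines/hemisphere-affine-slaving.lean`, planner
`planner-cruxplan-stmt-AtomisticToContinuum-9518-hemisphere-affine-sl-0`, skeleton registered on the item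
with the six stubs `stub_balanceIdentity`, `stub_affineSlaving`, `stub_fluxMomentChaos`,
`stub_thermodynamicVirial`, `stub_weightedKineticRelaxation`, `stub_slavingReduction`). It makes the
line's vocabulary IMPORTABLE so that each registered stub can land in its own sorry-free Theorems file
with the registered signature verbatim: the types `Cfg, Flows` (with the tree's `T3`, `V3`), the block fields `rhoB, mB, EB, uB, thetaB, pkin, Dst, qfl`
(verbatim bodies of the crux's / 9522's `let`s), the collisional pressure `pcoll`, the test weights
`eulerW, kinW, affW`, the sphere-moment chaos average `sphNum, sphDen, chaosNum, chaosDen, chaosAvg`, the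
collision-side jumps `dV, dE, jumpK, rawK, slavedK` and sums `Jfun, Sraw, Sfun`, the right-hand sides
`Rhs, Kfun`, the crux's own observable `Obs` and residual `Cc`, and the statements `BalanceFor` [S1],
`AffineSlavingIdentity` [lever], `FluxMomentChaos` [A'], `ThermoVirial` [B], `RelaxC` [C],
`ConclusionAtFlow` (verbatim the crux's tail after `∀ Φ`), `FMRAt` / `ExpMomAt` / `WindowAt`
(verbatim tails of the route items 9522 / 9519 (i) / 9519 (ii)), `NiceProfiles`, `AdmissibleKernel`.
All bodies are copied byte-for-byte from the registered skeleton; nothing is asserted here (every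
`def … : Prop` is a predicate the stubs prove or consume, never a hypothesis taken as a fact).
Two sorry-free lemmas record the pathwise use of the lever (`rawK_eq_slavedK`, `Sraw_eq_Sfun`) and
`conclusionAtFlow_iff` records that the crux's `let`-telescope is this file's vocabulary (`Iff.rfl`).

The mathematics (idea card `hemisphere-affine-slaving`, triage r1-1/2/3 pass ×3): collision by
collision the crux's residual is the jump sum `J_N`; the `⟪g,ω⟫²`-weighted average of the mark factor
`ω⊗ω:∇ψ + (V·ω)(ω·∇χ)` over uniform normals and the block pair law is, for EVERY velocity law, the
affine function `(1/3)[div ψ + ū·∇χ + (2/5)(D:∇ψ + Dū·∇χ)/(ρ̄θ̄) + (3/5)q·∇χ/(ρ̄θ̄)]` of the block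
kinetic moments (sphere moments `∫ω_aω_b = (4π/3)δ`, `∫ω_aω_bω_cω_d = (4π/15)(δδ+δδ+δδ)`; Enskog's
collisional transfer, Chapman–Cowling 1970 §16.4–16.6, Soto 2016 §4.8.1 (4.90)–(4.96); Irving–Kirkwood
1950; Spohn 1991 I §3.2), so that 9518 ⟸ [A'] raw two-flux-moment chaos ∧ lever ∧ [B] thermodynamic
virial ∧ [C] `(Z−1)`-weighted weak kinetic relaxation ∧ bookkeeping.
-/

namespace Summit.AtomisticToContinuum.HydrodynamicLimit.Theorems.HemisphereAffineSlaving

open scoped BigOperators Topology Manifold Classical MeasureTheory ProbabilityTheory Matrix InnerProductSpace ComplexConjugate ContinuousMap ENNReal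
open Filter Set Function TopologicalSpace MeasureTheory

noncomputable section

-- `T3 = UnitAddTorus (Fin 3)`, `V3 = EuclideanSpace ℝ (Fin 3)` are the tree's abbreviations
-- (`Literature.MathematicalPhysics.KineticTheory.T3/V3`, HardSphereEuler.lean); every file of the
-- line re-opens them with this exact line so that the registered stub signatures resolve verbatim.
open Literature.MathematicalPhysics.KineticTheory (T3 V3)

/-! ## Types and the crux's hypotheses (verbatim the sibling line's, hence interchangeable) -/

/-- Phase space of `N + 1` spheres on `𝕋³` (the crux's configuration type). -/
abbrev Cfg (N : ℕ) : Type :=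
  Literature.Analysis.FluidPDE.Config (N + 1) (Fin 3) (UnitAddTorus (Fin 3))
/-- Families of hard-sphere flows at reduced density `σ` (the crux's `Φ`). -/
abbrev Flows (σ : ℝ) : Type :=
  (N : ℕ) → Literature.Analysis.FluidPDE.HardSphereFlow
    (Literature.Analysis.FluidPDE.Torus.geometry (Fin 3))
    (Literature.MathematicalPhysics.KineticTheory.hsDiameter σ N) (N + 1)

/-- Continuous positive profiles (the crux's hypotheses on `a₀, θ₀, u₀`). -/
def NiceProfiles (a₀ θ₀ : T3 → ℝ) (u₀ : T3 → V3) : Prop :=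
  Continuous a₀ ∧ Continuous θ₀ ∧ Continuous u₀ ∧ (∀ x, 0 < a₀ x) ∧ (∀ x, 0 < θ₀ x)

/-- Admissible kernel family at mesoscale `(N+1)^{-γ}` (verbatim the crux's conjunction). -/
def AdmissibleKernel (γ C : ℝ) (φ : ℕ → T3 → ℝ) : Prop :=
  (∀ N, Literature.Analysis.FunctionSpaces.Torus.IsSmooth (φ N)) ∧ (∀ N y, 0 ≤ φ N y) ∧ (∀ N, ∫ y, φ N y = 1) ∧ (∀ (N : ℕ) y, ((N : ℝ) + 1) ^ (-γ) ≤ Literature.Analysis.FluidPDE.Torus.euclidDist y 0 → φ N y = 0) ∧ (∀ (N : ℕ) y, φ N y ≤ C * ((N : ℝ) + 1) ^ (3 * γ)) ∧ (∀ (N : ℕ) y, ‖Literature.Analysis.FunctionSpaces.Torus.gradient (φ N) y‖ ≤ C * ((N : ℝ) + 1) ^ (4 * γ))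

/-! ## Block fields (verbatim bodies of the crux's / 9522's `let`s, as named definitions) -/

/-- Block density `ρ̄`. -/
def rhoB (φ : ℕ → T3 → ℝ) (N : ℕ) (z : Cfg N) (x : T3) : ℝ :=
  Literature.MathematicalPhysics.KineticTheory.empiricalDensityField z (fun y => φ N (y - x))
/-- Block momentum `m̄`. -/
def mB (φ : ℕ → T3 → ℝ) (N : ℕ) (z : Cfg N) (x : T3) : V3 :=
  Literature.MathematicalPhysics.KineticTheory.empiricalMomentumField z (fun y => φ N (y - x))
/-- Block energy `Ē`. -/
def EB (φ : ℕ → T3 → ℝ) (N : ℕ) (z : Cfg N) (x : T3) : ℝ :=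
  Literature.MathematicalPhysics.KineticTheory.empiricalEnergyField z (fun y => φ N (y - x))
/-- Block velocity `ū = m̄ / ρ̄` (junk `0` on empty blocks, as in the crux). -/
def uB (φ : ℕ → T3 → ℝ) (N : ℕ) (z : Cfg N) (x : T3) : V3 :=
  (rhoB φ N z x)⁻¹ • mB φ N z x
/-- Block temperature `θ̄ = (2/3)(Ē/ρ̄ − |m̄|²/(2ρ̄²))` (verbatim the crux's `θb`). -/
def thetaB (φ : ℕ → T3 → ℝ) (N : ℕ) (z : Cfg N) (x : T3) : ℝ :=
  2 / 3 * (EB φ N z x / rhoB φ N z x - ‖mB φ N z x‖ ^ 2 / (2 * rhoB φ N z x ^ 2))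
/-- Block kinetic pressure `ρ̄ θ̄` (one third of the trace of the block central kinetic stress). -/
def pkin (φ : ℕ → T3 → ℝ) (N : ℕ) (z : Cfg N) (x : T3) : ℝ :=
  rhoB φ N z x * thetaB φ N z x
/-- Collisional pressure `p_c(ρ, θ) = hsPressure σ ρ θ − ρθ = ρθ (Z(ρσ³) − 1)` (the crux's `pc`). -/
def pcoll (σ r th : ℝ) : ℝ :=
  Literature.MathematicalPhysics.KineticTheory.hsPressure σ r th - r * th
/-- Block traceless central kinetic stress `D_jk` (verbatim 9522's `D`, per unit volume). -/
def Dst (φ : ℕ → T3 → ℝ) (N : ℕ) (z : Cfg N) (x : T3) (j k : Fin 3) : ℝ :=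
  (∫ y, φ N (y.1 - x) * ((y.2 j - uB φ N z x j) * (y.2 k - uB φ N z x k))
      ∂(Literature.Analysis.FluidPDE.empiricalMeasure z)) -
    (if j = k then (∑ l : Fin 3, ∫ y, φ N (y.1 - x) * (y.2 l - uB φ N z x l) ^ 2
      ∂(Literature.Analysis.FluidPDE.empiricalMeasure z)) / 3 else 0)
/-- Block kinetic heat flux `q` (verbatim 9522's `q`, per unit volume). -/
def qfl (φ : ℕ → T3 → ℝ) (N : ℕ) (z : Cfg N) (x : T3) : V3 :=
  ∫ y, (φ N (y.1 - x) * ‖y.2 - uB φ N z x‖ ^ 2 / 2) • (y.2 - uB φ N z x)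
    ∂(Literature.Analysis.FluidPDE.empiricalMeasure z)

/-! ## Test-field weights -/

/-- `∂_b ψ_a (s, x)`. -/
def gradPsi (ψ : ℝ → T3 → V3) (s : ℝ) (x : T3) (a b : Fin 3) : ℝ :=
  Literature.Analysis.FunctionSpaces.Torus.gradient (fun y => ψ s y a) x b
/-- `∇χ (s, x)`. -/
def gradChi (χ : ℝ → T3 → ℝ) (s : ℝ) (x : T3) : V3 :=
  Literature.Analysis.FunctionSpaces.Torus.gradient (χ s) x
/-- `div ψ (s, x)`. -/
def divPsi (ψ : ℝ → T3 → V3) (s : ℝ) (x : T3) : ℝ :=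
  Literature.Analysis.FunctionSpaces.Torus.divergence (ψ s) x

/-- The EULER weight `div ψ + ∇χ·ū` (verbatim the crux's right-hand integrand before `p_c`). -/
def eulerW (ψ : ℝ → T3 → V3) (χ : ℝ → T3 → ℝ) (φ : ℕ → T3 → ℝ) (N : ℕ) (s : ℝ) (z : Cfg N)
    (x : T3) : ℝ :=
  divPsi ψ s x + ∑ j, gradChi χ s x j * uB φ N z x j

/-- The KINETIC-CORRECTION weight `(2/5)(D:∇ψ + (Dū)·∇χ)/(ρ̄θ̄) + (3/5) q·∇χ/(ρ̄θ̄)` — Enskog's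
universal factors `2/5`, `3/5`, which in THIS line are DERIVED (stub_affineSlaving) from the sphere
moments; per unit collisional pressure this is all the collisional transfer knows about the
non-Maxwellian part of the local velocity law. -/
def kinW (ψ : ℝ → T3 → V3) (χ : ℝ → T3 → ℝ) (φ : ℕ → T3 → ℝ) (N : ℕ) (s : ℝ) (z : Cfg N)
    (x : T3) : ℝ :=
  2 / 5 * ((∑ a, ∑ b, Dst φ N z x a b * gradPsi ψ s x a b) +
      (∑ a, ∑ b, Dst φ N z x a b * uB φ N z x b * gradChi χ s x a)) / pkin φ N z x +
    3 / 5 * (∑ a, qfl φ N z x a * gradChi χ s x a) / pkin φ N z x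

/-- The AFFINE WEIGHT per ordered contact pair and unit `(ε/2)|g·ω|`: `(eulerW + kinW)/3`, GUARDED
to `0` on blocks with `ρ̄θ̄ = 0` (no weighted particle, or no velocity dispersion among the weighted
particles — there the chaos average below is `0/0 = 0` too, so the lever is an exact identity; the
guard is inactive w.h.p. by the density window and Lebesgue-a.s.). -/
def affW (ψ : ℝ → T3 → V3) (χ : ℝ → T3 → ℝ) (φ : ℕ → T3 → ℝ) (N : ℕ) (s : ℝ) (z : Cfg N)
    (x : T3) : ℝ :=
  if pkin φ N z x = 0 then 0 else (eulerW ψ χ φ N s z x + kinW ψ χ φ N s z x) / 3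

/-! ## The lever: the flux-weighted chaos average of the mark factor over the block pair law -/

/-- Sphere-side numerator at incoming velocities `v, v'` (`g = v − v'`, `V = (v + v')/2`):
`∫_{S²} ⟪g,ω⟫² [Σ_ab ω_a ω_b ∂_bψ_a(s,x) + ⟪V,ω⟫ Σ_a ω_a ∂_aχ(s,x)] dσ(ω)` over the unit sphere of
`V3` with its surface measure `volume.toSphere` (total mass `4π`). The integrand is EVEN in `ω`, so
this is twice Enskog's incoming-hemisphere integral `∫_{⟪g,ω⟫<0}` (Chapman–Cowling 1970 §16.5 (2),
§16.6 (2); Soto 2016 (4.91)–(4.93)): one factor `|⟪g,ω⟫|` is the collision FLUX, the other the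
jump magnitude `‖Δv_i‖`. -/
def sphNum (ψ : ℝ → T3 → V3) (χ : ℝ → T3 → ℝ) (s : ℝ) (x : T3) (v v' : V3) : ℝ :=
  ∫ ω : Metric.sphere (0 : V3) 1,
      inner ℝ (v - v') (ω : V3) ^ 2 *
        ((∑ a, ∑ b, (ω : V3) a * (ω : V3) b * gradPsi ψ s x a b) +
          inner ℝ ((1 / 2 : ℝ) • (v + v')) (ω : V3) * (∑ a, (ω : V3) a * gradChi χ s x a))
    ∂((volume : Measure V3).toSphere)

/-- Sphere-side flux normaliser `∫_{S²} ⟪g,ω⟫² dσ(ω)` (`= (4π/3)‖g‖²` by the second sphere moment). -/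
def sphDen (v v' : V3) : ℝ :=
  ∫ ω : Metric.sphere (0 : V3) 1, inner ℝ (v - v') (ω : V3) ^ 2 ∂((volume : Measure V3).toSphere)

/-- Block numerator: `sphNum` averaged over the block PAIR law `ν_x ⊗ ν_x`, `ν_x := φ_N(· − x) μ_w`
(product of the kernel-windowed one-body empirical law with itself — the "chaos" ansatz for the two
flux moments of the contact measure). A finite double sum. -/
def chaosNum (ψ : ℝ → T3 → V3) (χ : ℝ → T3 → ℝ) (φ : ℕ → T3 → ℝ) (N : ℕ) (s : ℝ) (w : Cfg N)
    (x : T3) : ℝ :=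
  ∫ y, (∫ y', φ N (y.1 - x) * φ N (y'.1 - x) * sphNum ψ χ s x y.2 y'.2
    ∂(Literature.Analysis.FluidPDE.empiricalMeasure w)) ∂(Literature.Analysis.FluidPDE.empiricalMeasure w)

/-- Block flux normaliser: `sphDen` averaged over `ν_x ⊗ ν_x` (`= (4π/3)·2ρ̄·tr M = 8π ρ̄² θ̄`). -/
def chaosDen (φ : ℕ → T3 → ℝ) (N : ℕ) (w : Cfg N) (x : T3) : ℝ :=
  ∫ y, (∫ y', φ N (y.1 - x) * φ N (y'.1 - x) * sphDen y.2 y'.2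
    ∂(Literature.Analysis.FluidPDE.empiricalMeasure w)) ∂(Literature.Analysis.FluidPDE.empiricalMeasure w)

/-- The flux-weighted CHAOS AVERAGE of the mark factor in the block at `x` (self-normalised: a
ratio of two averages over the trajectory's own block pair law; junk `0/0 = 0` on degenerate
blocks). -/
def chaosAvg (ψ : ℝ → T3 → V3) (χ : ℝ → T3 → ℝ) (φ : ℕ → T3 → ℝ) (N : ℕ) (s : ℝ) (w : Cfg N)
    (x : T3) : ℝ :=
  chaosNum ψ χ φ N s w x / chaosDen φ N w x

/-- **THE LEVER, as a statement.** For every nonnegative kernel and every test field whose time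
slice `ψ s` is smooth in space (lead's reshape 1: for a NON-differentiable `ψ s` the crux's
`Torus.divergence` — a sum of 1-D partial derivatives — and the trace `Σ_a gradPsi a a` of the
Fréchet-based `Torus.gradient` may differ by junk values, so the unrestricted identity is false;
the line only ever uses it at collision times `s ∈ (0, τ] ⊆ [0, t]`, where the slices of a
space–time-smooth test are smooth, `IsSmoothSpaceTimeOn.isSmooth_slice`) the chaos average IS the
guarded affine weight: `chaosAvg = affW`, i.e. off degenerate blocks
`chaosAvg = (1/3)[div ψ + ū·∇χ + (2/5)(D:∇ψ + Dū·∇χ)/(ρ̄θ̄) + (3/5) q·∇χ/(ρ̄θ̄)]`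
— an exact identity of finite sums and sphere moments (`∫_{S²} ω_aω_b dσ = (4π/3)δ_ab`,
`∫_{S²} ω_aω_bω_cω_d dσ = (4π/15)(δ_abδ_cd + δ_acδ_bd + δ_adδ_bc)`; `⟨g_ag_b⟩ = 2ρ̄M_ab`,
`⟨|g|²V⟩ = 6ρ̄²θ̄ū + 2ρ̄q`, `⟨g(g·V)⟩ = 2ρ̄Mū + 2ρ̄q` with `M = D + ρ̄θ̄𝟙`, `tr M = 3ρ̄θ̄`), valid for
EVERY velocity law: the trace/Euler part sees only `(ρ̄, ū, θ̄_kin)`, the non-Maxwellian content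
enters only through `D`, `q` with the universal factors `2/5`, `3/5`. -/
def AffineSlavingIdentity : Prop :=
  ∀ (ψ : ℝ → T3 → V3) (χ : ℝ → T3 → ℝ) (φ : ℕ → T3 → ℝ) (N : ℕ) (s : ℝ) (w : Cfg N) (x : T3),
    Literature.Analysis.FunctionSpaces.Torus.IsSmooth (ψ s) → (∀ y, 0 ≤ φ N y) →
    chaosAvg ψ χ φ N s w x = affW ψ χ φ N s w x

/-! ## Collision side: jumps of an ordered contact pair, read off the post-collisional configuration -/

/-- Velocity jump `Δv_i = v_i⁺ − v_i⁻` of the FIRST partner of the ordered contact pair `(i, j)` of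
the (post-collisional) configuration `w`; the incoming velocities are recovered by the elastic
involution `reflectVel` at the separation vector (as in `HardSphereCollisionRecord.ofConfig`).
At a genuine collision `Δv_i = |g·ω| ω`, `‖Δv_i‖ = |g·ω|`. -/
def dV (N : ℕ) (w : Cfg N) (i j : Fin (N + 1)) : V3 :=
  (w i).2 - (Literature.Analysis.FluidPDE.reflectVel
    ((Literature.Analysis.FluidPDE.Torus.geometry (Fin 3)).sepVec (w i).1 (w j).1)
    ((w i).2, (w j).2)).1

/-- Kinetic-energy jump `Δ(|v_i|²/2)` of the first partner (`= |g·ω| (V·ω)` at a genuine collision,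
`V` the centre-of-mass velocity of the pair). -/
def dE (N : ℕ) (w : Cfg N) (i j : Fin (N + 1)) : ℝ :=
  (‖(w i).2‖ ^ 2 - ‖(Literature.Analysis.FluidPDE.reflectVel
    ((Literature.Analysis.FluidPDE.Torus.geometry (Fin 3)).sepVec (w i).1 (w j).1)
    ((w i).2, (w j).2)).1‖ ^ 2) / 2

/-- JUMP KERNEL of the crux's observable: `ψ(s, x_i)·Δv_i + χ(s, x_i) Δ(|v_i|²/2)` (summed over
the two orientations of a pair this is `(ψ(x_i) − ψ(x_j))·Δv_i + (χ(x_i) − χ(x_j)) Δ(|v_i|²/2)`). -/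
def jumpK (ψ : ℝ → T3 → V3) (χ : ℝ → T3 → ℝ) (N : ℕ) (s : ℝ) (w : Cfg N) (i j : Fin (N + 1)) : ℝ :=
  inner ℝ (ψ s (w i).1) (dV N w i j) + χ s (w i).1 * dE N w i j

/-- RAW CHAOS KERNEL: `(ε_N/2)·|g·ω|·chaosAvg(s, x_i)` — the collision is kept (time, place and its
own flux weight `|g·ω| = ‖Δv_i‖`), only its mark factor is replaced by the chaos average of the
block it sits in (`ε/2` per ORDERED pair from `ψ(x_i) − ψ(x_j) = ε(ω·∇)ψ`). -/
def rawK (σ : ℝ) (ψ : ℝ → T3 → V3) (χ : ℝ → T3 → ℝ) (φ : ℕ → T3 → ℝ) (N : ℕ) (s : ℝ)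
    (w : Cfg N) (i j : Fin (N + 1)) : ℝ :=
  Literature.MathematicalPhysics.KineticTheory.hsDiameter σ N / 2 * ‖dV N w i j‖ *
    chaosAvg ψ χ φ N s w (w i).1

/-- SLAVED (affine) KERNEL: `(ε_N/2)·|g·ω|·affW(s, x_i) = (ε_N/6)|g·ω|[eulerW + kinW](s, x_i)` off
degenerate blocks — the sibling line's `slavedK` with the junk guard. -/
def slavedK (σ : ℝ) (ψ : ℝ → T3 → V3) (χ : ℝ → T3 → ℝ) (φ : ℕ → T3 → ℝ) (N : ℕ) (s : ℝ)
    (w : Cfg N) (i j : Fin (N + 1)) : ℝ :=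
  Literature.MathematicalPhysics.KineticTheory.hsDiameter σ N / 2 * ‖dV N w i j‖ *
    affW ψ χ φ N s w (w i).1

/-- `J_N(z, τ)`: the normalised collision-jump sum over the ordered contact pairs of the orbit of
`z` with collision times in `(0, τ]` (`HardSphereFlow.collisionPairSum`). -/
def Jfun (σ : ℝ) (Φ : Flows σ) (ψ : ℝ → T3 → V3) (χ : ℝ → T3 → ℝ) (N : ℕ) (z : Cfg N)
    (τ : ℝ) : ℝ :=
  ((N : ℝ) + 1)⁻¹ * (Φ N).collisionPairSum (Ioc 0 τ) (jumpK ψ χ N) z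

/-- `Sraw_N(z, τ)`: the raw chaos-averaged collision sum (normalised by `(N+1)⁻¹`). -/
def Sraw (σ : ℝ) (Φ : Flows σ) (φ : ℕ → T3 → ℝ) (ψ : ℝ → T3 → V3) (χ : ℝ → T3 → ℝ) (N : ℕ)
    (z : Cfg N) (τ : ℝ) : ℝ :=
  ((N : ℝ) + 1)⁻¹ * (Φ N).collisionPairSum (Ioc 0 τ) (rawK σ ψ χ φ N) z

/-- `S_N(z, τ)`: the slaved (affine) collision sum `Σ_c (ε/6)|g·ω| [eulerW + kinW](s_c, x_c)`,
normalised by `(N+1)⁻¹`; its `eulerW`-part is the dynamical collisional-pressure measure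
`p_N := (N+1)⁻¹ Σ_ordered (ε/6)|g·ω| δ_{(s_c, x_c)}` tested against `div ψ + ū·∇χ`. -/
def Sfun (σ : ℝ) (Φ : Flows σ) (φ : ℕ → T3 → ℝ) (ψ : ℝ → T3 → V3) (χ : ℝ → T3 → ℝ) (N : ℕ)
    (z : Cfg N) (τ : ℝ) : ℝ :=
  ((N : ℝ) + 1)⁻¹ * (Φ N).collisionPairSum (Ioc 0 τ) (slavedK σ ψ χ φ N) z

/-- `Rhs_N(z, τ) = ∫₀^τ ∫ (div ψ + ∇χ·ū) p_c(ρ̄, θ̄)` — verbatim the crux's right-hand side. -/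
def Rhs (σ : ℝ) (Φ : Flows σ) (φ : ℕ → T3 → ℝ) (ψ : ℝ → T3 → V3) (χ : ℝ → T3 → ℝ) (N : ℕ)
    (z : Cfg N) (τ : ℝ) : ℝ :=
  ∫ s in Icc 0 τ, ∫ x, eulerW ψ χ φ N s ((Φ N).flow s z) x *
    pcoll σ (rhoB φ N ((Φ N).flow s z) x) (thetaB φ N ((Φ N).flow s z) x)

/-- `K_N(z, τ) = ∫₀^τ ∫ kinW · p_c(ρ̄, θ̄) = ∫₀^τ∫ (Z(ρ̄σ³) − 1)[(2/5)(D:∇ψ + Dū·∇χ) + (3/5)q·∇χ]`: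
the `(Z−1)`-weighted weak kinetic functional (verbatim the sibling's). -/
def Kfun (σ : ℝ) (Φ : Flows σ) (φ : ℕ → T3 → ℝ) (ψ : ℝ → T3 → V3) (χ : ℝ → T3 → ℝ) (N : ℕ)
    (z : Cfg N) (τ : ℝ) : ℝ :=
  ∫ s in Icc 0 τ, ∫ x, kinW ψ χ φ N s ((Φ N).flow s z) x *
    pcoll σ (rhoB φ N ((Φ N).flow s z) x) (thetaB φ N ((Φ N).flow s z) x)

/-! ## The crux's own functional `Cc` (verbatim) -/

/-- The tested observable `O(s, z) = ⟨μ_z, ψ_s·v + χ_s |v|²/2⟩` (verbatim the crux's `O`). -/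
def Obs (ψ : ℝ → T3 → V3) (χ : ℝ → T3 → ℝ) (N : ℕ) (s : ℝ) (z : Cfg N) : ℝ :=
  ∫ y, ((∑ j, ψ s y.1 j * y.2 j) + χ s y.1 * (‖y.2‖ ^ 2 / 2))
    ∂(Literature.Analysis.FluidPDE.empiricalMeasure z)

/-- The crux's collisional residual `Cc(τ)` (verbatim the crux's `Cc`, with `O := Obs ψ χ`). -/
def Cc (σ : ℝ) (Φ : Flows σ) (ψ : ℝ → T3 → V3) (χ : ℝ → T3 → ℝ) (N : ℕ) (z : Cfg N) (τ : ℝ) : ℝ :=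
  Obs ψ χ N τ ((Φ N).flow τ z) - Obs ψ χ N 0 ((Φ N).flow 0 z) -
    ∫ s in Icc 0 τ, ((∫ y, ((∑ j, Literature.Analysis.FunctionSpaces.Torus.timeDeriv ψ s y.1 j * y.2 j) +
      Literature.Analysis.FunctionSpaces.Torus.timeDeriv χ s y.1 * (‖y.2‖ ^ 2 / 2))
        ∂(Literature.Analysis.FluidPDE.empiricalMeasure ((Φ N).flow s z))) +
      deriv (fun r : ℝ => Obs ψ χ N s (Literature.Analysis.FluidPDE.freeFlight
        (Literature.Analysis.FluidPDE.Torus.geometry (Fin 3)) r ((Φ N).flow s z))) 0)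

/-! ## The statements of the line -/

/-- **[S1] BALANCE IDENTITY** at `(σ, Φ)`: for every `N`, `t > 0`, smooth space–time tests on
`[0, t]`, every GOOD initial datum and every `τ ∈ [0, t]`, the crux's residual IS the normalised
collision-jump sum over `(0, τ]`: `Cc(τ) = J_N(z, τ)` (verbatim the sibling's `BalanceFor`). -/
def BalanceFor (σ : ℝ) (Φ : Flows σ) : Prop :=
  ∀ (N : ℕ) (t : ℝ), 0 < t → ∀ (ψ : ℝ → T3 → V3) (χ : ℝ → T3 → ℝ),
    Literature.Analysis.FunctionSpaces.Torus.IsSmoothSpaceTimeOn (Icc 0 t) ψ →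
    Literature.Analysis.FunctionSpaces.Torus.IsSmoothSpaceTimeOn (Icc 0 t) χ →
    ∀ z ∈ (Φ N).good, ∀ τ ∈ Icc 0 t, Cc σ Φ ψ χ N z τ = Jfun σ Φ ψ χ N z τ

/-- **[A'] RAW TWO-FLUX-MOMENT CHAOS AT CONTACT** at `(σ, profiles, Φ, kernel, t, ψ, χ)`: uniformly
in `τ ≤ t`, `J_N − Sraw_N → 0` in local-Gibbs probability — the `|g·ω|`-weighted empirical law of
the collision marks `(ω, v⁻, v_*⁻)`, tested against the two polynomial mark factors `ω⊗ω` and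
`(V·ω)ω` with block-smooth coefficients, is block by block the `⟪g,ω⟫²`-weighted average over
UNIFORM normals and the PRODUCT of the block one-body velocity law (two Hoeffding projections of
the collision U-statistic; no Enskog constant, no equation of state, no Maxwellian in the statement). -/
def FluxMomentChaos (σ : ℝ) (a₀ θ₀ : T3 → ℝ) (u₀ : T3 → V3) (Φ : Flows σ) (φ : ℕ → T3 → ℝ)
    (t : ℝ) (ψ : ℝ → T3 → V3) (χ : ℝ → T3 → ℝ) : Prop :=
  ∀ δ : ℝ, 0 < δ → Tendsto (fun N : ℕ =>
    Literature.MathematicalPhysics.KineticTheory.localGibbsLaw σ a₀ u₀ θ₀ N (Φ N)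
      {z | ∃ τ ∈ Icc 0 t, δ < |Jfun σ Φ ψ χ N z τ - Sraw σ Φ φ ψ χ N z τ|}) atTop (𝓝 0)

/-- **[B] THERMODYNAMIC VIRIAL** at `(σ, profiles, Φ, kernel, t, ψ, χ)`: uniformly in `τ ≤ t`,
`S_N − (Rhs_N + K_N) → 0` in probability — the dynamical collisional-pressure measure
`p_N(ds dx) = (N+1)⁻¹ Σ_ordered (ε/6)|g·ω| δ_{(s_c, x_c)}` equals `p_c(ρ̄, θ̄) ds dx =
ρ̄θ̄ (Z(ρ̄σ³) − 1) ds dx` when tested against the block-measurable weight `eulerW + kinW` (ONE scalar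
statement: de-fluxed contact intensity `= ρ̄² Y(ρ̄σ³)` with `(2π/3) η Y(η) = Z(η) − 1` to all orders;
isotropy of the normals is already inside [A']). -/
def ThermoVirial (σ : ℝ) (a₀ θ₀ : T3 → ℝ) (u₀ : T3 → V3) (Φ : Flows σ) (φ : ℕ → T3 → ℝ) (t : ℝ)
    (ψ : ℝ → T3 → V3) (χ : ℝ → T3 → ℝ) : Prop :=
  ∀ δ : ℝ, 0 < δ → Tendsto (fun N : ℕ =>
    Literature.MathematicalPhysics.KineticTheory.localGibbsLaw σ a₀ u₀ θ₀ N (Φ N)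
      {z | ∃ τ ∈ Icc 0 t, δ < |Sfun σ Φ φ ψ χ N z τ -
        (Rhs σ Φ φ ψ χ N z τ + Kfun σ Φ φ ψ χ N z τ)|}) atTop (𝓝 0)

/-- **[C] `(Z−1)`-WEIGHTED WEAK KINETIC RELAXATION** at `(σ, profiles, Φ, kernel, t, ψ, χ)`:
uniformly in `τ ≤ t`, `K_N → 0` in probability (verbatim the sibling's `RelaxC`). -/
def RelaxC (σ : ℝ) (a₀ θ₀ : T3 → ℝ) (u₀ : T3 → V3) (Φ : Flows σ) (φ : ℕ → T3 → ℝ) (t : ℝ)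
    (ψ : ℝ → T3 → V3) (χ : ℝ → T3 → ℝ) : Prop :=
  ∀ δ : ℝ, 0 < δ → Tendsto (fun N : ℕ =>
    Literature.MathematicalPhysics.KineticTheory.localGibbsLaw σ a₀ u₀ θ₀ N (Φ N)
      {z | ∃ τ ∈ Icc 0 t, δ < |Kfun σ Φ φ ψ χ N z τ|}) atTop (𝓝 0)

/-! ## Inputs docked BY NAME from the route (verbatim tails of the route decls) -/

/-- The conclusion of the CRUX at `(σ, a₀, θ₀, u₀, Φ)`: verbatim the text of
`CollisionIsometryCLT.CollisionalTransferLocality` after `∀ Φ …,` (so that the composition closes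
by `exact`). -/
def ConclusionAtFlow (σ : ℝ) (a₀ θ₀ : T3 → ℝ) (u₀ : T3 → V3) (Φ : Flows σ) : Prop :=
  ∀ (γ C : ℝ) (φ : ℕ → (UnitAddTorus (Fin 3)) → ℝ), 0 < γ → γ ≤ 1 / 15 → ((∀ N, Literature.Analysis.FunctionSpaces.Torus.IsSmooth (φ N)) ∧ (∀ N y, 0 ≤ φ N y) ∧ (∀ N, ∫ y, φ N y = 1) ∧ (∀ (N : ℕ) y, ((N : ℝ) + 1) ^ (-γ) ≤ Literature.Analysis.FluidPDE.Torus.euclidDist y 0 → φ N y = 0) ∧ (∀ (N : ℕ) y, φ N y ≤ C * ((N : ℝ) + 1) ^ (3 * γ)) ∧ (∀ (N : ℕ) y, ‖Literature.Analysis.FunctionSpaces.Torus.gradient (φ N) y‖ ≤ C * ((N : ℝ) + 1) ^ (4 * γ))) → let ρb := fun (N : ℕ) (z : Literature.Analysis.FluidPDE.Config (N + 1) (Fin 3) (UnitAddTorus (Fin 3))) (x : (UnitAddTorus (Fin 3))) => Literature.MathematicalPhysics.KineticTheory.empiricalDensityField z (fun y => φ N (y - x)); let mb := fun (N : ℕ)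 (z : Literature.Analysis.FluidPDE.Config (N + 1) (Fin 3) (UnitAddTorus (Fin 3))) (x : (UnitAddTorus (Fin 3))) => Literature.MathematicalPhysics.KineticTheory.empiricalMomentumField z (fun y => φ N (y - x)); let Eb := fun (N : ℕ) (z : Literature.Analysis.FluidPDE.Config (N + 1) (Fin 3) (UnitAddTorus (Fin 3))) (x : (UnitAddTorus (Fin 3))) => Literature.MathematicalPhysics.KineticTheory.empiricalEnergyField z (fun y => φ N (y - x)); let ub := fun (N : ℕ) (z : Literature.Analysis.FluidPDE.Config (N + 1) (Fin 3) (UnitAddTorus (Fin 3))) (x : (UnitAddTorus (Fin 3))) => (ρb N z x)⁻¹ • mb N z x; let θb := fun (N : ℕ) (z : Literature.Analysis.FluidPDE.Config (N + 1) (Fin 3) (UnitAddTorus (Fin 3))) (x : (UnitAddTorus (Fin 3))) => 2 / 3 * (Eb N z x / ρb N z x - ‖mb N z x‖ ^ 2 / (2 * ρb N z x ^ 2)); let pc := fun (r th : ℝ) => Literature.MathematicalPhysics.KineticTheory.hsPressure σ r th - r * th; ∀ t : ℝ, 0 < t → ∀ (ψ : ℝ → (UnitAddTorus (Fin 3)) →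 (EuclideanSpace ℝ (Fin 3))) (χ : ℝ → (UnitAddTorus (Fin 3)) → ℝ), Literature.Analysis.FunctionSpaces.Torus.IsSmoothSpaceTimeOn (Icc 0 t) ψ → Literature.Analysis.FunctionSpaces.Torus.IsSmoothSpaceTimeOn (Icc 0 t) χ → let O := fun (N : ℕ) (s : ℝ) (z : Literature.Analysis.FluidPDE.Config (N + 1) (Fin 3) (UnitAddTorus (Fin 3))) => ∫ y, ((∑ j, ψ s y.1 j * y.2 j) + χ s y.1 * (‖y.2‖ ^ 2 / 2)) ∂(Literature.Analysis.FluidPDE.empiricalMeasure z); let Cc := fun (N : ℕ) (z : Literature.Analysis.FluidPDE.Config (N + 1) (Fin 3) (UnitAddTorus (Fin 3))) (τ : ℝ) => O N τ ((Φ N).flow τ z) - O N 0 ((Φ N).flow 0 z) - ∫ s in Icc 0 τ, ((∫ y, ((∑ j, Literature.Analysis.FunctionSpaces.Torus.timeDeriv ψ s y.1 j * y.2 j) + Literature.Analysis.FunctionSpaces.Torus.timeDeriv χ s y.1 * (‖y.2‖ ^ 2 / 2)) ∂(Literature.Analysis.FluidPDE.empiricalMeasure ((Φ N).flow s z))) +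 deriv (fun r : ℝ => O N s (Literature.Analysis.FluidPDE.freeFlight (Literature.Analysis.FluidPDE.Torus.geometry (Fin 3)) r ((Φ N).flow s z))) 0); ∀ δ : ℝ, 0 < δ → Tendsto (fun N : ℕ => Literature.MathematicalPhysics.KineticTheory.localGibbsLaw σ a₀ u₀ θ₀ N (Φ N) {z | ∃ τ ∈ Icc 0 t, δ < |Cc N z τ - ∫ s in Icc 0 τ, ∫ x, (Literature.Analysis.FunctionSpaces.Torus.divergence (ψ s) x + ∑ j, Literature.Analysis.FunctionSpaces.Torus.gradient (χ s) x j * ub N ((Φ N).flow s z) x j) * pc (ρb N ((Φ N).flow s z) x) (θb N ((Φ N).flow s z) x)|}) atTop (𝓝 0)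

/-- KINETIC CLOSURE at `(σ, a₀, θ₀, u₀)`: verbatim the conclusion of the target 9522
`FastMomentRelaxation` after `σ < σ₀ →` (consumed only by [C]). -/
def FMRAt (σ : ℝ) (a₀ θ₀ : T3 → ℝ) (u₀ : T3 → V3) : Prop :=
  ∀ Φ : (N : ℕ) → Literature.Analysis.FluidPDE.HardSphereFlow (Literature.Analysis.FluidPDE.Torus.geometry (Fin 3)) (Literature.MathematicalPhysics.KineticTheory.hsDiameter σ N) (N + 1), ∀ (γ C : ℝ) (φ : ℕ → (UnitAddTorus (Fin 3)) → ℝ), 0 < γ → γ ≤ 1 / 15 → ((∀ N, Literature.Analysis.FunctionSpaces.Torus.IsSmooth (φ N)) ∧ (∀ N y, 0 ≤ φ N y) ∧ (∀ N, ∫ y, φ N y = 1) ∧ (∀ (N : ℕ) y, ((N : ℝ) + 1) ^ (-γ) ≤ Literature.Analysis.FluidPDE.Torus.euclidDist y 0 → φ N y = 0) ∧ (∀ (N : ℕ) y, φ N y ≤ C * ((N : ℝ) + 1) ^ (3 * γ)) ∧ (∀ (N : ℕ) y, ‖Literature.Analysis.FunctionSpaces.Torus.gradient (φ N) y‖ ≤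 C * ((N : ℝ) + 1) ^ (4 * γ))) → let ρb := fun (N : ℕ) (z : Literature.Analysis.FluidPDE.Config (N + 1) (Fin 3) (UnitAddTorus (Fin 3))) (x : (UnitAddTorus (Fin 3))) => Literature.MathematicalPhysics.KineticTheory.empiricalDensityField z (fun y => φ N (y - x)); let mb := fun (N : ℕ) (z : Literature.Analysis.FluidPDE.Config (N + 1) (Fin 3) (UnitAddTorus (Fin 3))) (x : (UnitAddTorus (Fin 3))) => Literature.MathematicalPhysics.KineticTheory.empiricalMomentumField z (fun y => φ N (y - x)); let ub := fun (N : ℕ) (z : Literature.Analysis.FluidPDE.Config (N + 1) (Fin 3) (UnitAddTorus (Fin 3))) (x : (UnitAddTorus (Fin 3))) => (ρb N z x)⁻¹ • mb N z x; let D := fun (N : ℕ) (z : Literature.Analysis.FluidPDE.Config (N + 1) (Fin 3) (UnitAddTorus (Fin 3))) (x : (UnitAddTorus (Fin 3))) (j k : Fin 3) => (∫ y, φ N (y.1 - x) * ((y.2 j - ub N z x j) * (y.2 k - ub N z x k)) ∂(Literature.Analysis.FluidPDE.empiricalMeasure z)) - (if j = k then (∑ l : Fin 3, ∫ y, φ N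 (y.1 - x) * (y.2 l - ub N z x l) ^ 2 ∂(Literature.Analysis.FluidPDE.empiricalMeasure z)) / 3 else 0); let q := fun (N : ℕ) (z : Literature.Analysis.FluidPDE.Config (N + 1) (Fin 3) (UnitAddTorus (Fin 3))) (x : (UnitAddTorus (Fin 3))) => ∫ y, (φ N (y.1 - x) * ‖y.2 - ub N z x‖ ^ 2 / 2) • (y.2 - ub N z x) ∂(Literature.Analysis.FluidPDE.empiricalMeasure z); ∀ t : ℝ, 0 < t → ∀ δ : ℝ, 0 < δ → Tendsto (fun N : ℕ => Literature.MathematicalPhysics.KineticTheory.localGibbsLaw σ a₀ u₀ θ₀ N (Φ N) {z | δ < ∫ s in Icc 0 t, ∫ x, ((∑ j, ∑ k, D N ((Φ N).flow s z) x j k ^ 2) + ‖q N ((Φ N).flow s z) x‖ ^ 2)}) atTop (𝓝 0)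

/-- TIME-AVERAGED EXPONENTIAL VELOCITY MOMENT at `(σ, profiles, Φ, t)`: verbatim component (i) of
crux 9519 `AprioriBounds`. -/
def ExpMomAt (σ : ℝ) (a₀ θ₀ : T3 → ℝ) (u₀ : T3 → V3) (Φ : Flows σ) (t : ℝ) : Prop :=
  ∃ lam Cexp : ℝ, 0 < lam ∧ Tendsto (fun N : ℕ => Literature.MathematicalPhysics.KineticTheory.localGibbsLaw σ a₀ u₀ θ₀ N (Φ N) {z | Cexp < ∫ s in Icc 0 t, ∫ y, Real.exp (lam * ‖y.2‖ ^ 2) ∂(Literature.Analysis.FluidPDE.empiricalMeasure ((Φ N).flow s z))}) atTop (𝓝 0)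

/-- DENSITY WINDOW at `(σ, profiles, Φ, t, kernel)`: verbatim the conclusion of component (ii) of
crux 9519 `AprioriBounds` (`c₁ ≤ ρ̄`, `ρ̄σ³ ≤ 1` for all `s ≤ t` and `x`, w.h.p.). -/
def WindowAt (σ : ℝ) (a₀ θ₀ : T3 → ℝ) (u₀ : T3 → V3) (Φ : Flows σ) (t : ℝ)
    (φ : ℕ → T3 → ℝ) : Prop :=
  ∃ c₁ : ℝ, 0 < c₁ ∧ Tendsto (fun N : ℕ => Literature.MathematicalPhysics.KineticTheory.localGibbsLaw σ a₀ u₀ θ₀ N (Φ N) {z | ∃ s ∈ Icc 0 t, ∃ x : (UnitAddTorus (Fin 3)), Literature.MathematicalPhysics.KineticTheory.empiricalDensityField ((Φ N).flow s z) (fun y => φ N (y - x)) < c₁ ∨ 1 < Literature.MathematicalPhysics.KineticTheory.empiricalDensityField ((Φ N).flow s z) (fun y => φ N (y - x)) * σ ^ 3}) atTop (𝓝 0)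

/-- The crux's conclusion at `(σ, profiles, Φ)` UNFOLDED: its `let`-bound block fields, `pc`, `O`,
`Cc` and right-hand side are this file's `rhoB`, `thetaB`, `uB`, `pcoll`, `Obs`, `Cc`, `Rhs`
definitionally (`Iff.rfl`), and its kernel hypothesis is `AdmissibleKernel`. This is the form in
which `stub_slavingReduction` delivers it. -/
theorem conclusionAtFlow_iff (σ : ℝ) (a₀ θ₀ : T3 → ℝ) (u₀ : T3 → V3) (Φ : Flows σ) :
    ConclusionAtFlow σ a₀ θ₀ u₀ Φ ↔
      ∀ (γ C : ℝ) (φ : ℕ → T3 → ℝ), 0 < γ → γ ≤ 1 / 15 → AdmissibleKernel γ C φ →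
        ∀ t : ℝ, 0 < t → ∀ (ψ : ℝ → T3 → V3) (χ : ℝ → T3 → ℝ),
          Literature.Analysis.FunctionSpaces.Torus.IsSmoothSpaceTimeOn (Icc 0 t) ψ →
          Literature.Analysis.FunctionSpaces.Torus.IsSmoothSpaceTimeOn (Icc 0 t) χ →
          ∀ δ : ℝ, 0 < δ → Tendsto (fun N : ℕ =>
            Literature.MathematicalPhysics.KineticTheory.localGibbsLaw σ a₀ u₀ θ₀ N (Φ N)
              {z | ∃ τ ∈ Icc 0 t, δ < |Cc σ Φ ψ χ N z τ - Rhs σ Φ φ ψ χ N z τ|}) atTop (𝓝 0) :=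
  Iff.rfl

/-! ## The pathwise use of the lever (sorry-free) -/

/-- The lever under the collision sum: given the identity, for a nonnegative kernel the raw and the
slaved kernels coincide POINTWISE (so `Sraw_N = S_N` pathwise, with no probability and no window —
this is how `stub_slavingReduction` uses `stub_affineSlaving`). -/
theorem rawK_eq_slavedK (hId : AffineSlavingIdentity) (σ : ℝ) {ψ : ℝ → T3 → V3} (χ : ℝ → T3 → ℝ)
    (φ : ℕ → T3 → ℝ) (N : ℕ) (hφ : ∀ y, 0 ≤ φ N y) {s : ℝ}
    (hψ : Literature.Analysis.FunctionSpaces.Torus.IsSmooth (ψ s)) (w : Cfg N) (i j : Fin (N + 1)) :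
    rawK σ ψ χ φ N s w i j = slavedK σ ψ χ φ N s w i j := by
  simp only [rawK, slavedK, hId ψ χ φ N s w (w i).1 hψ hφ]

/-- Hence the raw and slaved collision sums over the window `(0, τ]` agree pathwise for a
nonnegative kernel and a test field with smooth slices on `(0, τ]` (the collision pair sum only
evaluates the kernels at collision times in `(0, τ]`). -/
theorem Sraw_eq_Sfun : AffineSlavingIdentity → ∀ (σ : ℝ) (Φ : Flows σ) (φ : ℕ → T3 → ℝ) (ψ : ℝ → T3 → V3) (χ : ℝ → T3 → ℝ) (N : ℕ), (∀ y, 0 ≤ φ N y) → ∀ (z : Cfg N) (τ : ℝ), (∀ s ∈ Ioc 0 τ, Literature.Analysis.FunctionSpaces.Torus.IsSmooth (ψ s)) → Sraw σ Φ φ ψ χ N z τ = Sfun σ Φ φ ψ χ N z τ := by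
  intro hId σ Φ φ ψ χ N hφ z τ hψ
  unfold Sraw Sfun Literature.Analysis.FluidPDE.HardSphereFlow.collisionPairSum
    Literature.Analysis.FluidPDE.collisionPairSum
  congr 1
  refine finsum_mem_congr rfl fun t ht => ?_
  exact Finset.sum_congr rfl fun p _ => rawK_eq_slavedK hId σ χ φ N hφ (hψ t ht.2) _ p.1 p.2

end

end Summit.AtomisticToContinuum.HydrodynamicLimit.Theorems.HemisphereAffineSlaving
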